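import Literature.MathematicalPhysics.QuantumLattice.HubbardSliceSymbolSmoothMomentum
import HarnessLib

/-!
# All-order band jets of the free resolvent `ξ ↦ c/(−i(ω+θ) + ξ)`: closed form `c·(−1)ⁿ·n!/(−i(ω+θ)+ξ)^{n+1}` and the bound `|c|·n!/|ω+θ|^{n+1}`

Topic `MathematicalPhysics/QuantumLattice`; cell gate-hubbard-kl, K3 gen-8-flow S6 door (2) (the k ≤ 4 JET response of the one-shot covariance to a
frame shift; design memo `HOME/p2-g10/JET-RESPONSE-DESIGN-p2g10.md` item L1).  The tree has the first two `ξ`-derivatives of `resolventFnXi`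
(`resolventFnXiD1/D2`, `HubbardSliceSymbolSmoothMomentum`); the jet chain needs every order (Leibniz/Faà di Bruno against the cutoff weight, Mathlib
`norm_iteratedFDeriv_mul_le` / `norm_iteratedFDeriv_comp_le`).  At a nonzero (fermionic) frequency `ω + θ ≠ 0` the denominator never vanishes on `ℝ`, so:

* `shiftDen_ne_zero_of_freq_ne` / `abs_freq_le_norm_shiftDen` — `−i(ω+θ) + ξ ≠ 0` and `|ω+θ| ≤ ‖−i(ω+θ) + ξ‖`;
* `contDiff_resolventFnXi` — `ξ ↦ R(ξ)` is `C^∞` on `ℝ`;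
* **`iteratedDeriv_resolventFnXi`** — `iteratedDeriv n R ξ = c·(−1)ⁿ·n!/(−i(ω+θ)+ξ)^{n+1}`;
* **`norm_iteratedDeriv_resolventFnXi_le`** — `‖iteratedDeriv n R ξ‖ ≤ |c|·n!/|ω+θ|^{n+1}` (and `= |c|·n!/‖−i(ω+θ)+ξ‖^{n+1}`), plus the `iteratedFDeriv` form.

Everything is proved; no definitions; no named facts.

## Sources

G. Benfatto, A. Giuliani, V. Mastropietro, Ann. Henri Poincaré 7 (2006) 809–898, §2.1 (2.3), §2.2 (2.36aa) [`BenfattoGiulianiMastropietro2006`].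
-/

noncomputable section

namespace Literature.MathematicalPhysics.QuantumLattice

open Complex

variable {c θ ω : ℝ}

/-- At a nonzero frequency the shifted denominator never vanishes on the real band axis. [cite: BenfattoGiulianiMastropietro2006, §2.1 (2.3)] -/
theorem shiftDen_ne_zero_of_freq_ne (hω : ω + θ ≠ 0) (ξ : ℝ) : (-I * ((ω + θ : ℝ) : ℂ) + (ξ : ℂ)) ≠ 0 := by
  intro h
  have := congrArg Complex.im h
  simp at this
  exact hω (by linarith)

/-- `|ω+θ| ≤ ‖−i(ω+θ) + ξ‖` (the imaginary part). [cite: BenfattoGiulianiMastropietro2006, §2.1 (2.3)] -/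
theorem abs_freq_le_norm_shiftDen (θ ω ξ : ℝ) : |ω + θ| ≤ ‖-I * ((ω + θ : ℝ) : ℂ) + (ξ : ℂ)‖ := by
  have h := Complex.abs_im_le_norm (-I * ((ω + θ : ℝ) : ℂ) + (ξ : ℂ))
  have him : (-I * ((ω + θ : ℝ) : ℂ) + (ξ : ℂ)).im = -(ω + θ) := by simp
  rwa [him, abs_neg] at h

/-- **The resolvent is `C^∞` in the band** at a nonzero frequency. [cite: BenfattoGiulianiMastropietro2006, §2.2 (2.36aa)] -/
theorem contDiff_resolventFnXi (hω : ω + θ ≠ 0) {N : WithTop ℕ∞} : ContDiff ℝ N (resolventFnXi c θ ω) := by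
  have hden : ContDiff ℝ N (fun ξ : ℝ => -I * ((ω + θ : ℝ) : ℂ) + (ξ : ℂ)) :=
    contDiff_const.add Complex.ofRealCLM.contDiff
  have h : ContDiff ℝ N (fun ξ : ℝ => (c : ℂ) * (-I * ((ω + θ : ℝ) : ℂ) + (ξ : ℂ))⁻¹) :=
    contDiff_const.mul (hden.inv fun ξ => shiftDen_ne_zero_of_freq_ne hω ξ)
  have heq : resolventFnXi c θ ω = fun ξ : ℝ => (c : ℂ) * (-I * ((ω + θ : ℝ) : ℂ) + (ξ : ℂ))⁻¹ := by
    funext ξ; rw [resolventFnXi, div_eq_mul_inv]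
  rw [heq]; exact h

/-- One band derivative of the closed form: `d/dξ [C/(a+ξ)^{n+1}] = −(n+1)·C/(a+ξ)^{n+2}` (`a = −i(ω+θ)`, `a + ξ ≠ 0`).
[cite: BenfattoGiulianiMastropietro2006, §2.1 (2.3)] -/
theorem hasDerivAt_const_div_shiftDen_pow (hω : ω + θ ≠ 0) (C : ℂ) (n : ℕ) (ξ : ℝ) :
    HasDerivAt (fun t : ℝ => C / (-I * ((ω + θ : ℝ) : ℂ) + (t : ℂ)) ^ (n + 1))
      (-((n + 1 : ℕ) : ℂ) * C / (-I * ((ω + θ : ℝ) : ℂ) + (ξ : ℂ)) ^ (n + 2)) ξ := by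
  set a : ℂ := -I * ((ω + θ : ℝ) : ℂ) with ha
  have hne : a + (ξ : ℂ) ≠ 0 := shiftDen_ne_zero_of_freq_ne hω ξ
  have hpow : HasDerivAt (fun t : ℝ => (a + (t : ℂ)) ^ (n + 1)) (((n + 1 : ℕ) : ℂ) * (a + (ξ : ℂ)) ^ n * 1) ξ :=
    (hasDerivAt_shiftDen_xi θ ω ξ).pow (n + 1)
  have hpne : (a + (ξ : ℂ)) ^ (n + 1) ≠ 0 := pow_ne_zero _ hne
  have hinv := (hpow.inv hpne).const_mul C
  refine hinv.congr_of_eventuallyEq (Filter.Eventually.of_forall fun t => by simp [div_eq_mul_inv]) |>.congr_deriv ?_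
  field_simp
  ring

/-- **Closed form of every band derivative of the resolvent**: `iteratedDeriv n R ξ = c·(−1)ⁿ·n!/(−i(ω+θ) + ξ)^{n+1}` (`ω + θ ≠ 0`).
[cite: BenfattoGiulianiMastropietro2006, §2.2 (2.36aa)] -/
theorem iteratedDeriv_resolventFnXi (hω : ω + θ ≠ 0) (n : ℕ) (ξ : ℝ) :
    iteratedDeriv n (resolventFnXi c θ ω) ξ = (c : ℂ) * (-1) ^ n * (n.factorial : ℂ) / (-I * ((ω + θ : ℝ) : ℂ) + (ξ : ℂ)) ^ (n + 1) := by
  suffices h : iteratedDeriv n (resolventFnXi c θ ω) =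
      fun ξ : ℝ => (c : ℂ) * (-1) ^ n * (n.factorial : ℂ) / (-I * ((ω + θ : ℝ) : ℂ) + (ξ : ℂ)) ^ (n + 1) by
    rw [h]
  induction n with
  | zero =>
      funext ξ
      rw [iteratedDeriv_zero, resolventFnXi]
      simp
  | succ n ih =>
      funext ξ
      rw [iteratedDeriv_succ, ih]
      rw [(hasDerivAt_const_div_shiftDen_pow hω ((c : ℂ) * (-1) ^ n * (n.factorial : ℂ)) n ξ).deriv]
      rw [Nat.factorial_succ, pow_succ]
      push_cast
      ring

/-- **Norm of every band derivative**: `‖iteratedDeriv n R ξ‖ = |c|·n!/‖−i(ω+θ) + ξ‖^{n+1}`. [cite: BenfattoGiulianiMastropietro2006, §2.2 (2.36aa)] -/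
theorem norm_iteratedDeriv_resolventFnXi (hω : ω + θ ≠ 0) (n : ℕ) (ξ : ℝ) :
    ‖iteratedDeriv n (resolventFnXi c θ ω) ξ‖ = |c| * n.factorial / ‖-I * ((ω + θ : ℝ) : ℂ) + (ξ : ℂ)‖ ^ (n + 1) := by
  rw [iteratedDeriv_resolventFnXi hω, norm_div, norm_pow, norm_mul, norm_mul, Complex.norm_real, Real.norm_eq_abs, norm_pow, norm_neg,
    norm_one, one_pow, mul_one, Complex.norm_natCast]

/-- **The all-order jet bound**: `‖iteratedDeriv n R ξ‖ ≤ |c|·n!/|ω+θ|^{n+1}` (`ω + θ ≠ 0`). [cite: BenfattoGiulianiMastropietro2006, §2.2 (2.36aa)] -/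
theorem norm_iteratedDeriv_resolventFnXi_le (hω : ω + θ ≠ 0) (n : ℕ) (ξ : ℝ) :
    ‖iteratedDeriv n (resolventFnXi c θ ω) ξ‖ ≤ |c| * n.factorial / |ω + θ| ^ (n + 1) := by
  rw [norm_iteratedDeriv_resolventFnXi hω]
  have h0 : 0 < |ω + θ| := abs_pos.2 hω
  exact div_le_div_of_nonneg_left (by positivity) (by positivity)
    (pow_le_pow_left₀ (abs_nonneg _) (abs_freq_le_norm_shiftDen θ ω ξ) _)

/-- The `iteratedFDeriv` form of the jet bound (what `norm_iteratedFDeriv_mul_le` / `norm_iteratedFDeriv_comp_le` consume).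
[cite: BenfattoGiulianiMastropietro2006, §2.2 (2.36aa)] -/
theorem norm_iteratedFDeriv_resolventFnXi_le (hω : ω + θ ≠ 0) (n : ℕ) (ξ : ℝ) :
    ‖iteratedFDeriv ℝ n (resolventFnXi c θ ω) ξ‖ ≤ |c| * n.factorial / |ω + θ| ^ (n + 1) := by
  rw [norm_iteratedFDeriv_eq_norm_iteratedDeriv]
  exact norm_iteratedDeriv_resolventFnXi_le hω n ξ

end Literature.MathematicalPhysics.QuantumLattice

end
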